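import Mathlib
import Literature.RingTheory.CohomologyAnnihilator.LocalGlobal
import Literature.RingTheory.CohomologyAnnihilator.Localization
import Literature.RingTheory.CohomologyAnnihilator.RegularLocalRing
import HarnessLib

/-!
# Rung S-2 `PersistenceSurface` (stmt-ResolutionOfSingularities-19970), stub C1 (`Sat₄`) — LOCALIZATION TRANSPORT at an
# ISOLATED SINGULAR POINT: `caⁿ(R_𝔪) = caⁿ(R)·R_𝔪` and `caⁿ(R_𝔪) ∩ R = caⁿ(R)` above the regularity threshold off `𝔪`

[OURS · cell decomp-res · rung S-2; seat leafhand-res-homologicalconduct-15 gen 0]  Nothing here is a statement of the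
manuscript under review (Hironaka 2017); AI-written, weaker than expert review.  DEF-FREE.

Route `ResolutionOfSingularities/HomologicalConductor`, registered stub `stub_saturationFourSurfaceResidualFour`
(`Sat₄` residual, skeleton 1a77c002), class (iii) «`Sat₄` at the non-Gorenstein rational (toric) stages».  The cell's
theorem of record `…PersistenceCyclicQuotientAllCharFree.cohomologyAnnihilatorOfDegree_eq_cyclicQuotient_charFree`
gives `caᵐ(U) = ca(U)` (`m ≥ 4`) for the GRADED model `U = k[u,v]^{(n;1,q)}`; the stage of the tower is a LOCAL ring.
Hand 13-g1's repair census names the transport «graded model → local / complete stage» as item (a).  This file does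
the LOCALIZATION half once and for all, for any commutative noetherian ring `R` and any maximal ideal `𝔪` which is
the only point where `caⁿ` is not the unit ideal («isolated singular point at level `n`»):

* `comap_cohomologyAnnihilatorOfDegree_atPrime_eq` — if `caⁿ(R_𝔫) = R_𝔫` for every maximal `𝔫 ≠ 𝔪`, then
  `caⁿ(R_𝔪) ∩ R = caⁿ(R)` (local–global principle in the fixed degree `n`, tree `…LocalGlobal`, + IT Lemma 2.10 (1));
* `cohomologyAnnihilatorOfDegree_atPrime_eq_map` — hence `caⁿ(R_𝔪) = caⁿ(R)·R_𝔪` (`IsLocalization.map_under`);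
  `…_of_isLocalization` — the same for any `IsLocalization.AtPrime S 𝔪`;
* `cohomologyAnnihilatorOfDegree_atPrime_eq_of_levelled` / `cohomologyAnnihilator_atPrime_eq_caAt` — LEVELLED
  SATURATION passes to the local ring: `caᵐ(R) = caᵃ(R)` for all `m ≥ a` (with `a` at least the threshold) gives
  `caᵐ(R_𝔪) = caᵃ(R_𝔪)` for all `m ≥ a` and `ca(R_𝔪) = caᵃ(R_𝔪)`;
* `comap_cohomologyAnnihilator_atPrime_eq` / `cohomologyAnnihilator_atPrime_eq_map` /
  `algebraMap_mem_cohomologyAnnihilator_atPrime_iff` — the EXACT CENTRE passes too: `ca(R_𝔪) ∩ R = ca(R)`,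
  `ca(R_𝔪) = ca(R)·R_𝔪`, `x/1 ∈ ca(R_𝔪) ↔ x ∈ ca(R)`;
* `cohomologyAnnihilatorOfDegree_eq_top_of_isRegularLocalRing_of_lt` and
  `caAt_atPrime_eq_top_of_isRegularLocalRing_off` — the threshold hypothesis from REGULARITY off `𝔪`: if `R_𝔫` is a
  regular local ring for every maximal `𝔫 ≠ 𝔪` and `dim R ≤ d`, then `caⁿ(R_𝔫) = R_𝔫` for all `n ≥ d + 1`
  ([IyengarTakahashi2014, Example 2.5]).

NOT done here (the other half of item (a), sized in the seat's census): the passage `R_𝔪 ⇝ (R_𝔪)^` LEVEL BY LEVEL.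
[BahlekehHakimianSalarianTakahashi2015, Thm. 4.5 (2)] only gives `caⁿ(R_𝔪) ⊆ caⁿ⁺ᵈ(R̂_𝔪) ∩ R_𝔪`, so the graded
theorem yields `Sat₆`, not `Sat₄`, at a stage with toric completion; level-exact ascent needs the punctured-free
retract mechanism (tree `…CompletionTheorem.exists_retract_baseChange_of_puncturedFree`) run on second syzygies.

References: S. B. Iyengar, R. Takahashi, IMRN 2016, arXiv:1404.1476, Def. 2.1, Lemma 2.10, Example 2.5
[`IyengarTakahashi2014`] — used only through landed tree lemmas; folklore (local–global principle).
-/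

-- single-problem summit: the doubled namespace component `ResolutionOfSingularities` is forced
set_option linter.dupNamespace false

noncomputable section

open IsLocalRing Literature.RingTheory.CohomologyAnnihilator

universe u

namespace Summit.ResolutionOfSingularities.ResolutionOfSingularities.Theorems.HomologicalConductor.PersistenceSurfaceSaturationIsolatedLocalization

/-! ## The regularity threshold -/

/-- **A regular local ring `S` with `dim S < n` has `caⁿ(S) = S`** (`dim S = d`, `caᵈ⁺¹(S) = S` by
[IyengarTakahashi2014, Example 2.5] / Serre, and the tower `caᵈ⁺¹ ⊆ caⁿ`). [cite: IyengarTakahashi2014, Example 2.5] -/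
theorem cohomologyAnnihilatorOfDegree_eq_top_of_isRegularLocalRing_of_lt {S : Type u} [CommRing S]
    [IsRegularLocalRing S] {n : ℕ} (hn : ringKrullDim S < n) : cohomologyAnnihilatorOfDegree S n = ⊤ := by
  have h1 : ringKrullDim S ≠ ⊥ := ringKrullDim_ne_bot
  have h2 : ringKrullDim S ≠ ⊤ := ringKrullDim_ne_top
  obtain ⟨a, ha⟩ := WithBot.ne_bot_iff_exists.mp h1
  have ha' : a ≠ ⊤ := fun h => h2 (by rw [← ha, h]; rfl)
  obtain ⟨d, rfl⟩ := WithTop.ne_top_iff_exists.mp ha'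
  have hd : ringKrullDim S = (d : ℕ) := ha.symm
  have hdn : d + 1 ≤ n := by
    rw [hd] at hn
    have : (d : ℕ∞) < (n : ℕ∞) := by exact_mod_cast (WithBot.coe_lt_coe.mp hn)
    have : d < n := by exact_mod_cast this
    omega
  exact top_le_iff.mp ((cohomologyAnnihilatorOfDegree_eq_top_of_isRegularLocalRing (R := S) hd).symm.le.trans
    (cohomologyAnnihilatorOfDegree_mono hdn))

variable {R : Type u} [CommRing R] [IsNoetherianRing R] (𝔪 : Ideal R) [𝔪.IsMaximal]

omit [IsNoetherianRing R] [𝔪.IsMaximal] in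
/-- **Threshold from regularity off `𝔪`.**  If `R_𝔫` is a regular local ring for every maximal ideal `𝔫 ≠ 𝔪` and
`dim R ≤ d`, then `caⁿ(R_𝔫) = R_𝔫` for every maximal `𝔫 ≠ 𝔪` and every `n ≥ d + 1`
(`dim R_𝔫 = ht 𝔫 ≤ dim R ≤ d < n`). [cite: IyengarTakahashi2014, Example 2.5] -/
theorem caAt_atPrime_eq_top_of_isRegularLocalRing_off {d : ℕ} (hdim : ringKrullDim R ≤ d)
    (hreg : ∀ (𝔫 : Ideal R) [𝔫.IsMaximal], 𝔫 ≠ 𝔪 → IsRegularLocalRing (Localization.AtPrime 𝔫))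
    {n : ℕ} (hn : d + 1 ≤ n) (𝔫 : Ideal R) [𝔫.IsMaximal] (h𝔫 : 𝔫 ≠ 𝔪) :
    cohomologyAnnihilatorOfDegree (Localization.AtPrime 𝔫) n = ⊤ := by
  haveI := hreg 𝔫 h𝔫
  refine cohomologyAnnihilatorOfDegree_eq_top_of_isRegularLocalRing_of_lt ?_
  calc ringKrullDim (Localization.AtPrime 𝔫) = 𝔫.height :=
        IsLocalization.AtPrime.ringKrullDim_eq_height 𝔫 (Localization.AtPrime 𝔫)
    _ ≤ ringKrullDim R := Ideal.height_le_ringKrullDim_of_isPrime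
    _ ≤ d := hdim
    _ < n := by exact_mod_cast (show d < n by omega)

/-! ## Exactness of `caⁿ` at an isolated singular point -/

/-- **`caⁿ(R_𝔪) ∩ R = caⁿ(R)` at an isolated singular point of level `n`.**  If `caⁿ(R_𝔫)` is the unit ideal for
every maximal `𝔫 ≠ 𝔪`, then the contraction of `caⁿ(R_𝔪)` to `R` is `caⁿ(R)`: `⊇` is [IyengarTakahashi2014,
Lemma 2.10 (1)]; `⊆` is the local–global principle in the FIXED degree `n` (tree
`mem_cohomologyAnnihilatorOfDegree_of_forall_isMaximal`), the test at `𝔫 ≠ 𝔪` being void. [this work] -/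
theorem comap_cohomologyAnnihilatorOfDegree_atPrime_eq {n : ℕ}
    (hoff : ∀ (𝔫 : Ideal R) [𝔫.IsMaximal], 𝔫 ≠ 𝔪 →
      cohomologyAnnihilatorOfDegree (Localization.AtPrime 𝔫) n = ⊤) :
    (cohomologyAnnihilatorOfDegree (Localization.AtPrime 𝔪) n).comap
        (algebraMap R (Localization.AtPrime 𝔪)) = cohomologyAnnihilatorOfDegree R n := by
  refine le_antisymm ?_ ?_
  · intro x hx
    rw [Ideal.mem_comap] at hx
    refine mem_cohomologyAnnihilatorOfDegree_of_forall_isMaximal x n fun 𝔫 _ => ?_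
    by_cases h : 𝔫 = 𝔪
    · subst h
      exact hx
    · rw [hoff 𝔫 h]
      exact Submodule.mem_top
  · intro x hx
    exact Ideal.mem_comap.mpr (algebraMap_mem_cohomologyAnnihilatorOfDegree 𝔪.primeCompl hx)

/-- **`caⁿ(R_𝔪) = caⁿ(R)·R_𝔪` at an isolated singular point of level `n`** (every ideal of a localisation is the
extension of its contraction, `IsLocalization.map_under`). [this work] -/
theorem cohomologyAnnihilatorOfDegree_atPrime_eq_map {n : ℕ}
    (hoff : ∀ (𝔫 : Ideal R) [𝔫.IsMaximal], 𝔫 ≠ 𝔪 →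
      cohomologyAnnihilatorOfDegree (Localization.AtPrime 𝔫) n = ⊤) :
    cohomologyAnnihilatorOfDegree (Localization.AtPrime 𝔪) n =
      (cohomologyAnnihilatorOfDegree R n).map (algebraMap R (Localization.AtPrime 𝔪)) := by
  rw [← comap_cohomologyAnnihilatorOfDegree_atPrime_eq 𝔪 hoff, ← Ideal.under_def,
    IsLocalization.map_under 𝔪.primeCompl]

/-- The same for ANY localisation `S` of `R` at `𝔪` (`IsLocalization.AtPrime S 𝔪`): `caⁿ(S) = caⁿ(R)·S`, transported
along `Localization.AtPrime 𝔪 ≃ₐ[R] S`. [this work] -/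
theorem cohomologyAnnihilatorOfDegree_eq_map_of_isLocalization (S : Type u) [CommRing S] [Algebra R S]
    [IsLocalization.AtPrime S 𝔪] {n : ℕ}
    (hoff : ∀ (𝔫 : Ideal R) [𝔫.IsMaximal], 𝔫 ≠ 𝔪 →
      cohomologyAnnihilatorOfDegree (Localization.AtPrime 𝔫) n = ⊤) :
    cohomologyAnnihilatorOfDegree S n = (cohomologyAnnihilatorOfDegree R n).map (algebraMap R S) := by
  let h := IsLocalization.algEquiv 𝔪.primeCompl (Localization.AtPrime 𝔪) S
  have hcomp : algebraMap R S =
      (h.toRingEquiv : Localization.AtPrime 𝔪 →+* S).comp (algebraMap R (Localization.AtPrime 𝔪)) := by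
    ext x
    simp [h]
  rw [hcomp, ← Ideal.map_map, ← cohomologyAnnihilatorOfDegree_atPrime_eq_map 𝔪 hoff,
    map_ringEquiv_cohomologyAnnihilatorOfDegree h.toRingEquiv n]

/-- The contraction form for any `IsLocalization.AtPrime S 𝔪`: `caⁿ(S) ∩ R = caⁿ(R)`. [this work] -/
theorem comap_cohomologyAnnihilatorOfDegree_eq_of_isLocalization (S : Type u) [CommRing S] [Algebra R S]
    [IsLocalization.AtPrime S 𝔪] {n : ℕ}
    (hoff : ∀ (𝔫 : Ideal R) [𝔫.IsMaximal], 𝔫 ≠ 𝔪 →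
      cohomologyAnnihilatorOfDegree (Localization.AtPrime 𝔫) n = ⊤) :
    (cohomologyAnnihilatorOfDegree S n).comap (algebraMap R S) = cohomologyAnnihilatorOfDegree R n := by
  refine le_antisymm ?_ ?_
  · intro x hx
    rw [Ideal.mem_comap, cohomologyAnnihilatorOfDegree_eq_map_of_isLocalization 𝔪 S hoff,
      IsLocalization.mem_map_algebraMap_iff 𝔪.primeCompl] at hx
    obtain ⟨⟨⟨a, ha⟩, s⟩, h⟩ := hx
    -- `x · s = a` up to a unit of `𝔪.primeCompl`: `t (x s) = t a` in `R` with `t ∉ 𝔪`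
    simp only at h
    rw [← map_mul] at h
    obtain ⟨t, ht⟩ := (IsLocalization.eq_iff_exists 𝔪.primeCompl S).mp h
    -- so `x · (s t) ∈ caⁿ(R)` with `s t ∉ 𝔪`; contract through `R_𝔪`
    rw [← comap_cohomologyAnnihilatorOfDegree_atPrime_eq 𝔪 hoff, Ideal.mem_comap]
    have hst : ((t : R) * (s : R)) ∈ 𝔪.primeCompl := Submonoid.mul_mem _ t.2 s.2
    have hu : IsUnit (algebraMap R (Localization.AtPrime 𝔪) ((t : R) * (s : R))) :=
      IsLocalization.map_units (Localization.AtPrime 𝔪) ⟨_, hst⟩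
    have hmem : algebraMap R (Localization.AtPrime 𝔪) ((t : R) * (s : R) * x) ∈
        cohomologyAnnihilatorOfDegree (Localization.AtPrime 𝔪) n := by
      have : (t : R) * (s : R) * x = (t : R) * a := by
        rw [← ht]; ring
      rw [this]
      exact algebraMap_mem_cohomologyAnnihilatorOfDegree 𝔪.primeCompl (Ideal.mul_mem_left _ _ ha)
    rw [map_mul] at hmem
    obtain ⟨v, hv⟩ := hu
    rw [← hv] at hmem
    exact (Submodule.smul_mem_iff_of_isUnit _ v.isUnit).mp hmem
  · rw [← Ideal.map_le_iff_le_comap]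
    exact map_cohomologyAnnihilatorOfDegree_le_of_isLocalization 𝔪.primeCompl S n

/-! ## Levelled saturation and the exact centre pass to the local ring -/

/-- From a levelled plateau `caᵐ(R) = caᵃ(R)` (`m ≥ a`) the cohomology annihilator IS the plateau: `ca(R) = caᵃ(R)`.
[folklore] -/
theorem cohomologyAnnihilator_eq_caAt_of_levelled {T : Type u} [CommRing T] {a : ℕ}
    (hsat : ∀ m : ℕ, a ≤ m → cohomologyAnnihilatorOfDegree T m = cohomologyAnnihilatorOfDegree T a) :
    cohomologyAnnihilator T = cohomologyAnnihilatorOfDegree T a := by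
  refine le_antisymm (iSup_le fun m => ?_) (cohomologyAnnihilatorOfDegree_le a)
  calc cohomologyAnnihilatorOfDegree T m ≤ cohomologyAnnihilatorOfDegree T (max m a) :=
        cohomologyAnnihilatorOfDegree_mono (le_max_left m a)
    _ = cohomologyAnnihilatorOfDegree T a := hsat _ (le_max_right m a)

/-- **Levelled saturation passes to `R_𝔪`.**  If `caᵃ(R_𝔫) = R_𝔫` for every maximal `𝔫 ≠ 𝔪` (so the same holds in
every degree `≥ a`) and `caᵐ(R) = caᵃ(R)` for all `m ≥ a`, then `caᵐ(R_𝔪) = caᵃ(R_𝔪)` for all `m ≥ a`. [this work] -/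
theorem cohomologyAnnihilatorOfDegree_atPrime_eq_of_levelled {a : ℕ}
    (hoff : ∀ (𝔫 : Ideal R) [𝔫.IsMaximal], 𝔫 ≠ 𝔪 →
      cohomologyAnnihilatorOfDegree (Localization.AtPrime 𝔫) a = ⊤)
    (hsat : ∀ m : ℕ, a ≤ m → cohomologyAnnihilatorOfDegree R m = cohomologyAnnihilatorOfDegree R a)
    (m : ℕ) (hm : a ≤ m) :
    cohomologyAnnihilatorOfDegree (Localization.AtPrime 𝔪) m =
      cohomologyAnnihilatorOfDegree (Localization.AtPrime 𝔪) a := by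
  have hoffm : ∀ (𝔫 : Ideal R) [𝔫.IsMaximal], 𝔫 ≠ 𝔪 →
      cohomologyAnnihilatorOfDegree (Localization.AtPrime 𝔫) m = ⊤ := fun 𝔫 _ h =>
    top_le_iff.mp ((hoff 𝔫 h).symm.le.trans (cohomologyAnnihilatorOfDegree_mono hm))
  rw [cohomologyAnnihilatorOfDegree_atPrime_eq_map 𝔪 hoffm, cohomologyAnnihilatorOfDegree_atPrime_eq_map 𝔪 hoff,
    hsat m hm]

/-- **`ca(R_𝔪) = caᵃ(R_𝔪)`** under the same hypotheses (`R_𝔪` is noetherian, so `ca(R_𝔪)` is some `caˢ(R_𝔪)`, and the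
plateau starts at `a`). [this work] -/
theorem cohomologyAnnihilator_atPrime_eq_caAt {a : ℕ}
    (hoff : ∀ (𝔫 : Ideal R) [𝔫.IsMaximal], 𝔫 ≠ 𝔪 →
      cohomologyAnnihilatorOfDegree (Localization.AtPrime 𝔫) a = ⊤)
    (hsat : ∀ m : ℕ, a ≤ m → cohomologyAnnihilatorOfDegree R m = cohomologyAnnihilatorOfDegree R a) :
    cohomologyAnnihilator (Localization.AtPrime 𝔪) = cohomologyAnnihilatorOfDegree (Localization.AtPrime 𝔪) a :=
  cohomologyAnnihilator_eq_caAt_of_levelled (cohomologyAnnihilatorOfDegree_atPrime_eq_of_levelled 𝔪 hoff hsat)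

/-- **The exact centre passes to `R_𝔪`, contraction form: `ca(R_𝔪) ∩ R = ca(R)`.** [this work] -/
theorem comap_cohomologyAnnihilator_atPrime_eq {a : ℕ}
    (hoff : ∀ (𝔫 : Ideal R) [𝔫.IsMaximal], 𝔫 ≠ 𝔪 →
      cohomologyAnnihilatorOfDegree (Localization.AtPrime 𝔫) a = ⊤)
    (hsat : ∀ m : ℕ, a ≤ m → cohomologyAnnihilatorOfDegree R m = cohomologyAnnihilatorOfDegree R a) :
    (cohomologyAnnihilator (Localization.AtPrime 𝔪)).comap (algebraMap R (Localization.AtPrime 𝔪)) =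
      cohomologyAnnihilator R := by
  rw [cohomologyAnnihilator_atPrime_eq_caAt 𝔪 hoff hsat, comap_cohomologyAnnihilatorOfDegree_atPrime_eq 𝔪 hoff,
    cohomologyAnnihilator_eq_caAt_of_levelled hsat]

/-- **The exact centre passes to `R_𝔪`, extension form: `ca(R_𝔪) = ca(R)·R_𝔪`.** [this work] -/
theorem cohomologyAnnihilator_atPrime_eq_map {a : ℕ}
    (hoff : ∀ (𝔫 : Ideal R) [𝔫.IsMaximal], 𝔫 ≠ 𝔪 →
      cohomologyAnnihilatorOfDegree (Localization.AtPrime 𝔫) a = ⊤)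
    (hsat : ∀ m : ℕ, a ≤ m → cohomologyAnnihilatorOfDegree R m = cohomologyAnnihilatorOfDegree R a) :
    cohomologyAnnihilator (Localization.AtPrime 𝔪) =
      (cohomologyAnnihilator R).map (algebraMap R (Localization.AtPrime 𝔪)) := by
  rw [cohomologyAnnihilator_atPrime_eq_caAt 𝔪 hoff hsat, cohomologyAnnihilatorOfDegree_atPrime_eq_map 𝔪 hoff,
    cohomologyAnnihilator_eq_caAt_of_levelled hsat]

/-- **The exact centre passes to `R_𝔪`, elementwise: `x/1 ∈ ca(R_𝔪) ↔ x ∈ ca(R)`** — so any TEST for membership in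
`ca(R)` (e.g. «`x` stably annihilates the cospecial pieces», the graded theorem's centre) is a test for `ca(R_𝔪)` on
numerators. [this work] -/
theorem algebraMap_mem_cohomologyAnnihilator_atPrime_iff {a : ℕ}
    (hoff : ∀ (𝔫 : Ideal R) [𝔫.IsMaximal], 𝔫 ≠ 𝔪 →
      cohomologyAnnihilatorOfDegree (Localization.AtPrime 𝔫) a = ⊤)
    (hsat : ∀ m : ℕ, a ≤ m → cohomologyAnnihilatorOfDegree R m = cohomologyAnnihilatorOfDegree R a) (x : R) :
    algebraMap R (Localization.AtPrime 𝔪) x ∈ cohomologyAnnihilator (Localization.AtPrime 𝔪) ↔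
      x ∈ cohomologyAnnihilator R := by
  rw [← Ideal.mem_comap, comap_cohomologyAnnihilator_atPrime_eq 𝔪 hoff hsat]

/-! ## Packaged with the regularity threshold -/

/-- **Levelled `Sat_a` at the local ring of an isolated singular point.**  `R` noetherian with `dim R ≤ d`, `R_𝔫`
regular for every maximal `𝔫 ≠ 𝔪`, `d + 1 ≤ a`, and `caᵐ(R) = caᵃ(R)` for all `m ≥ a` ⇒ `caᵐ(R_𝔪) = caᵃ(R_𝔪)` for
all `m ≥ a`, `ca(R_𝔪) = caᵃ(R_𝔪) = caᵃ(R)·R_𝔪`, and `x/1 ∈ ca(R_𝔪) ↔ x ∈ ca(R)`. [this work] -/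
theorem saturation_atPrime_of_isRegularLocalRing_off {d a : ℕ} (hdim : ringKrullDim R ≤ d)
    (hreg : ∀ (𝔫 : Ideal R) [𝔫.IsMaximal], 𝔫 ≠ 𝔪 → IsRegularLocalRing (Localization.AtPrime 𝔫))
    (ha : d + 1 ≤ a)
    (hsat : ∀ m : ℕ, a ≤ m → cohomologyAnnihilatorOfDegree R m = cohomologyAnnihilatorOfDegree R a) :
    (∀ m : ℕ, a ≤ m → cohomologyAnnihilatorOfDegree (Localization.AtPrime 𝔪) m =
        cohomologyAnnihilatorOfDegree (Localization.AtPrime 𝔪) a) ∧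
      cohomologyAnnihilator (Localization.AtPrime 𝔪) = cohomologyAnnihilatorOfDegree (Localization.AtPrime 𝔪) a ∧
      cohomologyAnnihilatorOfDegree (Localization.AtPrime 𝔪) a =
        (cohomologyAnnihilatorOfDegree R a).map (algebraMap R (Localization.AtPrime 𝔪)) ∧
      ∀ x : R, algebraMap R (Localization.AtPrime 𝔪) x ∈ cohomologyAnnihilator (Localization.AtPrime 𝔪) ↔
        x ∈ cohomologyAnnihilator R := by
  have hoff : ∀ (𝔫 : Ideal R) [𝔫.IsMaximal], 𝔫 ≠ 𝔪 →
      cohomologyAnnihilatorOfDegree (Localization.AtPrime 𝔫) a = ⊤ := fun 𝔫 _ h =>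
    caAt_atPrime_eq_top_of_isRegularLocalRing_off 𝔪 hdim hreg ha 𝔫 h
  exact ⟨cohomologyAnnihilatorOfDegree_atPrime_eq_of_levelled 𝔪 hoff hsat,
    cohomologyAnnihilator_atPrime_eq_caAt 𝔪 hoff hsat, cohomologyAnnihilatorOfDegree_atPrime_eq_map 𝔪 hoff,
    algebraMap_mem_cohomologyAnnihilator_atPrime_iff 𝔪 hoff hsat⟩

end Summit.ResolutionOfSingularities.ResolutionOfSingularities.Theorems.HomologicalConductor.PersistenceSurfaceSaturationIsolatedLocalization

end
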